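import Summits.BirchSwinnertonDyer.BirchSwinnertonDyer.Theorems.ClassRecordThreeEulerHalvesAtThreeOfExceptionalZeroRoadWithM

/-!
# Route `KolyvaginRoadThree` (rung K2@3, the Kolyvagin road on A1): the rung leaf
# `X11b.MultiplicativeRankOneAtThree` over the binders of ITS deciding theorem `closes`, with its crux
# `EulerHalvesAtThree` (the 19109 twin) and its five Shimura supports replaced by the exceptional-zero
# road KEYED ON «conj@3-WITH-m» + the explicit `3`-only residue (cell `bsd-stepL`, seat
# `bsd-stepL-mult-p4` g4; `--supports stmt-BirchSwinnertonDyer-19109`)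

Cell `bsd-stepL` (D-0131 (3) middle tier, seat `bsd-stepL-mult-p4`, lens «split-multiplicative
`r = 1` via the 𝓛-invariant `p`-adic Gross–Zagier + Kobayashi 2006»). THEOREMS ONLY, CONDITIONAL on
the PUBLISHED named facts in the binders and on the typed inputs named below; no definition, no new
fact, no `sorry`; nothing about any curve is asserted and no census word moves (TARGET T7).

This is the `KolyvaginRoadThree` twin of
`ExceptionalZeroRoad.multiplicativeRankOneAtThree_of_closesBinders_of_conjectureWithM_of_threeOnly_of_schneider`
(p554434, route `ClassRecordThree`): gen 3's
`kolyvaginRoadThree_multiplicativeRankOneAtThree_of_closesBinders_of_conjecture_of_schneider` (p552549)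
with its display hypothesis `hC` (conj@3 on ALL split X11b@3 ∩ `Surj` pairs) split along the cell's
audit grades into `hCm` (conj@3-WITH-m: pairs with a multiplicative `ℓ ≠ 3` — every brick of the
printed `p ≥ 5` proof located at `p = 3` or supplied, memo `HOME/mult-p4/EXZ-ROAD-MEMO-g4.md` §3) and
the `3`-ONLY residue `h₃` (the Euler half itself on split ¬(ram) ∩ `Surj` pairs with no such `ℓ`;
`ℚ^×`-grade in print). The three (ram) binders `hUβ`, `hUα`, `hUγ` of the kernel record
`multiplicativeRankOneAtThree_of_kolyRecord_upperB` take `hCm` only (a (ram) witness is a second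
multiplicative prime, `Three.exists_multiplicativePrime_ne_of_ram`, and forces `Surj W 3`); `hU₀` takes
`hCm` ∕ `h₃` ∕ the non-split road (Disegni 2020 Thm. 1 non-split clause, PUBLISHED at every odd `p`).
CONDITIONAL; closes nothing; the registered lines of 19109 are untouched.

References: [Disegni2020] Thm. 1 (§1.2) = Thm. 4 (§3.2), Prop. 5; [Wuthrich2014] Thm. 3, Cor. 19;
[SteinWuthrich2013] Thm. 6.1, §4.2; [LiuZhangZhang2018] Thms. 1.5.1, 1.5.3; [BertoliniDarmonPrasanna2013]
Thm. 5.4; cell files HOME/mult-p4/EXZ-ROAD-MEMO-g0…g4.md.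
-/

set_option autoImplicit false

-- Theorems files of this problem live in `Summit.BirchSwinnertonDyer.BirchSwinnertonDyer.Theorems.*`.
set_option linter.dupNamespace false

noncomputable section

open scoped Classical MatrixGroups ModularForm

open CongruenceSubgroup WeierstrassCurve Literature.NumberTheory.EllipticCurves
  Literature.NumberTheory.EllipticCurves.ModularForms
  Literature.NumberTheory.EllipticCurves.Rank1Residual
  Literature.NumberTheory.EllipticCurves.Rank1Residual.Typed
  Literature.NumberTheory.EllipticCurves.SteinWuthrich2013
  Literature.NumberTheory.EllipticCurves.Wuthrich2014

namespace Summit.BirchSwinnertonDyer.BirchSwinnertonDyer.Theorems.ExceptionalZeroRoad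

open Summit.BirchSwinnertonDyer.Rank1Residual Summit.BirchSwinnertonDyer.Rank1Residual.X11b
  Summit.BirchSwinnertonDyer.Rank1Residual.X11b.Three

/-- **Route `KolyvaginRoadThree` (rung-K2@3 leaf), over the binders of ITS `closes`, keyed on
conj@3-WITH-m**: `ZhangSharpFrameAtThreeHL` (the Kolyvagin road on A1), `SchneiderTamAtThree`,
`LZZWaldspurgerHeegner`, `IMCDivTwoLociTamAtThreeR`, `TateSenVanishingAtThree`, `BDPWaldspurgerSquare`,
`CornerAtThree`, `PublishedInputsKolyThree` — with its crux `EulerHalvesAtThree` AND its five Shimura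
supports REPLACED by: three further PUBLISHED facts (`hKato`, `hJs`, `hHs`); the audited display `hCm` on
split X11b@3 ∩ `Surj` pairs WITH a multiplicative `ℓ ≠ 3`; the `3`-ONLY residue `h₃`; the two Schneider
halves on their loci (`hSchS`, `hSchN`). The kernel record `multiplicativeRankOneAtThree_of_kolyRecord_upperB`
is fed exactly as `closes` feeds it except that `hUβ`, `hUα`, `hUγ` come from conj@3-WITH-m (the (ram)
prime being the second prime) and `hU₀` from `hCm` ∕ `h₃` ∕ Disegni's non-split clause. CONDITIONAL;
nothing booked. [cite: Disegni2020, Thm. 1 (§1.2) = Thm. 4 (§3.2), Prop. 5] [cite: Wuthrich2014, Thm. 3, Cor. 19]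
[cite: SteinWuthrich2013, Thm. 6.1, §4.2] [cite: LiuZhangZhang2018, Thm. 1.5.1, Thm. 1.5.3]
[cite: BertoliniDarmonPrasanna2013, Thm. 5.4] -/
theorem kolyvaginRoadThree_multiplicativeRankOneAtThree_of_closesBinders_of_conjectureWithM_of_threeOnly_of_schneider
    (h₁ : Summit.BirchSwinnertonDyer.BirchSwinnertonDyer.Theses.KolyvaginRoadThree.ZhangSharpFrameAtThreeHL)
    (h₂ : Summit.BirchSwinnertonDyer.BirchSwinnertonDyer.Theses.KolyvaginRoadThree.SchneiderTamAtThree)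
    (hLZZ : Summit.BirchSwinnertonDyer.BirchSwinnertonDyer.Theses.KolyvaginRoadThree.LZZWaldspurgerHeegner)
    (h3R : Summit.BirchSwinnertonDyer.BirchSwinnertonDyer.Theses.KolyvaginRoadThree.IMCDivTwoLociTamAtThreeR)
    (hTS : Summit.BirchSwinnertonDyer.BirchSwinnertonDyer.Theses.KolyvaginRoadThree.TateSenVanishingAtThree)
    (hW : Summit.BirchSwinnertonDyer.BirchSwinnertonDyer.Theses.KolyvaginRoadThree.BDPWaldspurgerSquare)
    (h₆ : Summit.BirchSwinnertonDyer.BirchSwinnertonDyer.Theses.KolyvaginRoadThree.CornerAtThree)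
    (h₇ : Summit.BirchSwinnertonDyer.BirchSwinnertonDyer.Theses.KolyvaginRoadThree.PublishedInputsKolyThree)
    (hKato : kato_charIdeal_dvd_multiplicative_of_surjective) (hJs : thm61_splitMultiplicative)
    (hHs : exists_isSplitMultCanonical)
    (hCm : ∀ (W : WeierstrassCurve ℚ) [W.IsElliptic] [W.IsGloballyMinimal], ClassX11b W 3 → Surj W 3 →
      W.HasSplitMultiplicativeReductionAtPrime 3 →
        (∃ ℓ : ℕ, ∃ _ : Fact ℓ.Prime, ℓ ≠ 3 ∧ W.HasMultiplicativeReductionAtPrime ℓ) →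
          ClassClosure.RelativeExceptionalLeadingTermAt W 3)
    (h₃ : ∀ (W : WeierstrassCurve ℚ) [W.IsElliptic] [W.IsGloballyMinimal], ClassX11b W 3 → Surj W 3 →
      ¬ Ram W 3 → W.HasSplitMultiplicativeReductionAtPrime 3 →
        (∀ (ℓ : ℕ) [Fact ℓ.Prime], ℓ ≠ 3 → ¬ W.HasMultiplicativeReductionAtPrime ℓ) →
          Typed.MissingUpperBoundAt W 3)
    (hSchS : ∀ (W : WeierstrassCurve ℚ) [W.IsElliptic] [W.IsGloballyMinimal], ClassX11b W 3 → Surj W 3 →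
      W.HasSplitMultiplicativeReductionAtPrime 3 → ∀ (Dq : TateParameterData W 3) (Dh : PAdicHeightData W 3),
        IsSplitMultCanonical Dh Dq → SchneiderConjecture Dh)
    (hSchN : ∀ (W : WeierstrassCurve ℚ) [W.IsElliptic] [W.IsGloballyMinimal], ClassX11b W 3 → ¬ Ram W 3 →
      Surj W 3 → ¬ W.HasSplitMultiplicativeReductionAtPrime 3 →
        ∀ (q : ℚ_[3]) (Dh : PAdicHeightData W 3), q ≠ 0 → ‖q‖ < 1 → tateJ q = (W.j : ℚ_[3]) →
          IsMultCanonical Dh q → SchneiderConjecture Dh) :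
    MultiplicativeRankOneAtThree := by
  have h₄ : Summit.BirchSwinnertonDyer.BirchSwinnertonDyer.Theses.KolyvaginRoadThree.HsiehDescentAtThree :=
    Summit.BirchSwinnertonDyer.BirchSwinnertonDyer.Theorems.WaldspurgerKernel.hsiehDescentAt₃_of_thm54_of_tateSen
      hW hTS
  have hV :=
    Summit.BirchSwinnertonDyer.BirchSwinnertonDyer.Theorems.LZZKernel.bdpValueAt₃_of_thm151_thm153 hLZZ
  have h₃' : Summit.BirchSwinnertonDyer.BirchSwinnertonDyer.Theses.KolyvaginRoadThree.HalvesTamAtThreeR :=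
    fun W _ _ hX ↦
      ⟨fun hram hsp htam ↦ ⟨hV W, (h3R W hX).1 hram hsp htam⟩, fun hnr hsurj ↦ ⟨hV W, (h3R W hX).2 hnr hsurj⟩⟩
  obtain ⟨⟨hGZ, hKo, hB, hSk, hWu, hGZK, hmod, hnf, hHL, hMaz, hPT, -, -, hSkA, hJn, hHn, hD, hpar, hMN, hH⟩,
    hMc, hrec, hKD⟩ := h₇
  -- the Euler half on every SPLIT (ram) X11b@3 pair: conj@3-WITH-m, the (ram) prime being the second prime
  have hspR : ∀ (W : WeierstrassCurve ℚ) [W.IsElliptic] [W.IsGloballyMinimal], ClassX11b W 3 → Ram W 3 →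
      W.HasSplitMultiplicativeReductionAtPrime 3 → Typed.MissingUpperBoundAt W 3 :=
    fun W _ _ hX hram hsplit ↦
      have hsurj : Surj W 3 := surj_of_irr_of_ram W 3 hX.2.2.2 hram
      Three.missingUpperBoundAt_of_surj_split_of_secondPrime_of_conjectureWithM_of_schneiderSplit W hKato
        hJs hHs hGZK hpar hX hsurj hsplit (Three.exists_multiplicativePrime_ne_of_ram W hram) hCm
        (hSchS W hX hsurj hsplit)
  exact multiplicativeRankOneAtThree_of_kolyRecord_upperB hGZ hKo hB hSk hWu hGZK hmod hnf hHL hMaz hPT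
    hSkA hJn hHn hD hpar hMN hH
    (fun W _ _ hX hram htam ↦
      Koly.bsdp_three_onA1_of_kolyvaginFramesHL hGZ hKo hB hSk hGZK hmod hnf hHL hMaz hrec hMc hKD h₁ W hX
        hram htam)
    h₂ (fun W _ _ hX ↦ (h₄ W hX).1) (fun W _ _ hX ↦ (h₃' W hX).1)
    (fun W _ _ hX hram hsplit _ _ _ ↦ hspR W hX hram hsplit)
    (fun W _ _ hX hram hα ↦ hspR W hX hram hα.1)
    (fun W _ _ hX hram hsplit _ _ ↦ hspR W hX hram hsplit)
    (fun W _ _ hX ↦ (h₄ W hX).2) (fun W _ _ hX ↦ (h₃' W hX).2)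
    (fun W _ _ hX hsurj hnr ↦ by
      by_cases hsplit : W.HasSplitMultiplicativeReductionAtPrime 3
      · by_cases hm : ∃ ℓ : ℕ, ∃ _ : Fact ℓ.Prime, ℓ ≠ 3 ∧ W.HasMultiplicativeReductionAtPrime ℓ
        · exact Three.missingUpperBoundAt_of_surj_split_of_secondPrime_of_conjectureWithM_of_schneiderSplit
            W hKato hJs hHs hGZK hpar hX hsurj hsplit hm hCm (hSchS W hX hsurj hsplit)
        · exact h₃ W hX hsurj hnr hsplit fun ℓ _ hne hmult ↦ hm ⟨ℓ, ‹_›, hne, hmult⟩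
      · exact Three.missingUpperBoundAt_of_surj_nonsplit_of_schneiderNonsplit W hKato hJn hHn hD hGZK
          hpar hX hsurj hsplit (hSchN W hX hnr hsurj hsplit))
    (fun W _ _ ↦ (h₆ W).1) (fun W _ _ ↦ (h₆ W).2.1) (fun W _ _ ↦ (h₆ W).2.2)

end Summit.BirchSwinnertonDyer.BirchSwinnertonDyer.Theorems.ExceptionalZeroRoad

end
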